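import Mathlib
import Summits.KontsevichZagierPeriods.Zeta5Search.RecordCellATwoPoint
import Summits.KontsevichZagierPeriods.Zeta5Search.ZeroEvaluationProof
import Summits.KontsevichZagierPeriods.Zeta5Search.ClusterValuationResidues
import HarnessLib

/-!
# ζ(5) search — the unit `ĝ_q` is a `p`-adic unit and is constant modulo `p` on a residue class (gen-2 g9's G1)

Cell `pub-zeta5` (HONEST FRAMING: systematic search; no irrationality claim unless certified), P1 prover seat
generation 5.  `gHat b p q = 2·∏_{s ∉ class(q)} (s − q)^{netExp s}·[b₀/2 − q]` (`ClusterValuation.gHat`, the value at the pole of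
the factors of `R_b` foreign to the class; the bracket only for an odd centre outside the class) is the unit in front of every
leading digit (Theorem B, `leadingDigit_holds`).  gen-2 g9 (REPORT-gen2-g9 §1.4, statement `GHatClassCongr` of the staged
`G9UniversalDigit.lean`, exact check 118,807 classes) records: **(G1) `v_p(ĝ_q) = 0`, and `ĝ_q ≡ ĝ_{q'} (mod p)` for `q, q'` in the
same class** — every factor is a `p`-adic unit and `s − q' ≡ s − q`.  Proved here with literally gen-2's statement body
(`gHat_classCongr`), generalising the two-point case `padicNorm_goutConst_sub_le` of `RecordCellATwoPoint`.  `p`-adic norms of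
rational numbers; nothing about irrationality.
-/

noncomputable section

open Finset

namespace Summit.KontsevichZagierPeriods.Zeta5Search.CellA

open Summit.KontsevichZagierPeriods.Zeta5Search.DualSeries (InBox)
open Summit.KontsevichZagierPeriods.Zeta5Search.CasoratianValuation (InPolytope)
open Summit.KontsevichZagierPeriods.Zeta5Search.ClusterValuation
open Summit.KontsevichZagierPeriods.Zeta5Search.PadicSeries

variable {p : ℕ} [hp : Fact p.Prime]

/-! ### Integer powers of congruent units -/

/-- `‖u^e‖ = 1` for a unit `u` and `e : ℤ`. -/
theorem padicNorm_zpow_unit {u : ℚ} (hu : padicNorm p u = 1) (e : ℤ) : padicNorm p (u ^ e) = 1 := by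
  rcases Int.eq_nat_or_neg e with ⟨m, rfl | rfl⟩
  · rw [zpow_natCast, padicNorm_pow_eq, hu, one_pow]
  · rw [zpow_neg, zpow_natCast, padicNorm_inv', padicNorm_pow_eq, hu, one_pow, inv_one]

/-- Integer powers of congruent units are congruent. -/
theorem padicNorm_zpow_sub_zpow_le {u v : ℚ} (hu : padicNorm p u = 1) (hv : padicNorm p v = 1)
    (huv : padicNorm p (u - v) ≤ (p : ℚ) ^ (-(1 : ℤ))) (e : ℤ) :
    padicNorm p (u ^ e - v ^ e) ≤ (p : ℚ) ^ (-(1 : ℤ)) := by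
  rcases Int.eq_nat_or_neg e with ⟨m, rfl | rfl⟩
  · rw [zpow_natCast, zpow_natCast]; exact padicNorm_pow_sub_pow_le hu.le hv.le huv m
  · rw [zpow_neg, zpow_neg, zpow_natCast, zpow_natCast]
    exact padicNorm_inv_sub_inv_le (by rw [padicNorm_pow_eq, hu, one_pow]) (by rw [padicNorm_pow_eq, hv, one_pow])
      (padicNorm_pow_sub_pow_le hu.le hv.le huv m)

/-- A non-zero rational of norm `1` has valuation `0`; of norm `≤ p⁻¹`, valuation `≥ 1`. -/
theorem padicValRat_eq_zero_of_norm_one {x : ℚ} (hx : x ≠ 0) (h : padicNorm p x = 1) : padicValRat p x = 0 := by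
  rw [padicNorm.eq_zpow_of_nonzero hx] at h
  have := zpow_right_injective₀ (by exact_mod_cast hp.out.pos) (by exact_mod_cast hp.out.one_lt.ne') (h.trans (zpow_zero _).symm)
  omega

/-! ### G1 -/

/-- For `s` outside the class of `q` (within `[0, b₀] ⊂ [0, p²)`… no window needed): `‖s − q‖_p = 1`. -/
theorem padicNorm_sub_eq_one_of_mod_ne {s q : ℕ} (h : s % p ≠ q % p) : padicNorm p ((s : ℚ) - q) = 1 := by
  have hz : ((s : ℚ) - q) = (((s : ℤ) - q : ℤ) : ℚ) := by push_cast; ring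
  rw [hz]
  refine (padicNorm.int_eq_one_iff _).2 fun hdvd => h ?_
  exact (Nat.modEq_iff_dvd.2 (by rw [dvd_sub_comm] at hdvd; exact_mod_cast hdvd)).symm ▸ rfl

/-- **G1 (gen-2 g9, `GHatClassCongr`)**: `ĝ_q` is a `p`-adic unit and `ĝ_q ≡ ĝ_{q'} (mod p)` for `q, q'` in the same residue class. -/
theorem gHat_classCongr : ∀ (b : ℕ → ℤ) (p x q q' : ℕ), InPolytope b → p.Prime → 5 ≤ p → x < p →
    q ∈ classSet b p x → q' ∈ classSet b p x →
      padicValRat p (gHat b p q) = 0 ∧ (gHat b p q ≠ gHat b p q' → 1 ≤ padicValRat p (gHat b p q - gHat b p q')) := by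
  intro b p x q q' hb hprime hp5 hx hq hq'
  haveI : Fact p.Prime := ⟨hprime⟩
  have hp2 : p ≠ 2 := by omega
  have hqx : q % p = x % p := (mem_filter.1 hq).2
  have hq'x : q' % p = x % p := (mem_filter.1 hq').2
  have htwo : padicNorm p (2 : ℚ) = 1 := by
    have := (padicNorm.nat_eq_one_iff (p := p) 2).2 (by
      intro h; exact hp2 ((Nat.prime_dvd_prime_iff_eq hprime Nat.prime_two).1 h))
    exact_mod_cast this
  -- the foreign product: termwise units, congruent between q and q'
  set S := (range ((b 0).toNat + 1)).filter (fun s => s % p ≠ q % p) with hS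
  have hS' : (range ((b 0).toNat + 1)).filter (fun s => s % p ≠ q' % p) = S := by rw [hS, hqx, hq'x]
  have hunit : ∀ r : ℕ, r % p = x % p → ∀ s ∈ S, padicNorm p (((s : ℚ) - r) ^ netExp b s) = 1 := by
    intro r hr s hs
    have hs' : s % p ≠ q % p := (mem_filter.1 hs).2
    exact padicNorm_zpow_unit (padicNorm_sub_eq_one_of_mod_ne (by rw [hr, ← hqx]; exact hs')) _
  have hprodq : padicNorm p (∏ s ∈ S, ((s : ℚ) - q) ^ netExp b s) = 1 := by
    have h1 := padicNorm_prod_le_one S _ fun s hs => (hunit q hqx s hs).le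
    -- a product of units is a unit: use the inverse bound via exactness termwise
    have : ∀ s ∈ S, padicNorm p (((s : ℚ) - q) ^ netExp b s) = (p : ℚ) ^ (-(0 : ℤ)) := fun s hs => by
      rw [hunit q hqx s hs]; simp
    have h2 := padicNorm_coeff_zero_prod S (fun _ => (0 : ℤ)) (fun s => PowerSeries.C (((s : ℚ) - q) ^ netExp b s))
      (fun s hs => by rw [PowerSeries.coeff_C, if_pos rfl]; exact this s hs)
    rw [← map_prod, PowerSeries.coeff_C, if_pos rfl] at h2
    simpa using h2
  have hprodq' : padicNorm p (∏ s ∈ S, ((s : ℚ) - q') ^ netExp b s) = 1 := by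
    have : ∀ s ∈ S, padicNorm p (((s : ℚ) - q') ^ netExp b s) = (p : ℚ) ^ (-(0 : ℤ)) := fun s hs => by
      rw [hunit q' hq'x s hs]; simp
    have h2 := padicNorm_coeff_zero_prod S (fun _ => (0 : ℤ)) (fun s => PowerSeries.C (((s : ℚ) - q') ^ netExp b s))
      (fun s hs => by rw [PowerSeries.coeff_C, if_pos rfl]; exact this s hs)
    rw [← map_prod, PowerSeries.coeff_C, if_pos rfl] at h2
    simpa using h2
  have hqq' : padicNorm p ((q : ℚ) - q') ≤ (p : ℚ) ^ (-(1 : ℤ)) := by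
    have hz : ((q : ℚ) - q') = (((q : ℤ) - q' : ℤ) : ℚ) := by push_cast; ring
    rw [hz]
    have hmod : Nat.ModEq p q' q := hq'x.trans hqx.symm
    have hdvd : ((p : ℕ) : ℤ) ^ 1 ∣ (q : ℤ) - q' := by
      rw [pow_one]; exact Nat.modEq_iff_dvd.1 hmod
    have := padicNorm.dvd_iff_norm_le.1 hdvd
    simpa using this
  have hproddiff : padicNorm p (∏ s ∈ S, ((s : ℚ) - q) ^ netExp b s - ∏ s ∈ S, ((s : ℚ) - q') ^ netExp b s) ≤
      (p : ℚ) ^ (-(1 : ℤ)) :=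
    padicNorm_prod_sub_prod_le S _ _ (fun s hs => (hunit q hqx s hs).le) (fun s hs => (hunit q' hq'x s hs).le)
      fun s hs => by
        have hs' : s % p ≠ q % p := (mem_filter.1 hs).2
        refine padicNorm_zpow_sub_zpow_le (padicNorm_sub_eq_one_of_mod_ne hs')
          (padicNorm_sub_eq_one_of_mod_ne (by rw [hq'x, ← hqx]; exact hs')) ?_ _
        have e : ((s : ℚ) - q) - ((s : ℚ) - q') = -((q : ℚ) - q') := by ring
        rw [e, padicNorm.neg]; exact hqq'
  -- the centre factor
  have hcenq : CentreIn b p q ↔ CentreIn b p x := centreIn_iff_of_mem hq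
  have hcenq' : CentreIn b p q' ↔ CentreIn b p x := centreIn_iff_of_mem hq'
  set cq : ℚ := if ¬ (2 : ℤ) ∣ b 0 ∧ ¬ CentreIn b p q then (b 0 : ℚ) / 2 - q else 1 with hcq
  set cq' : ℚ := if ¬ (2 : ℤ) ∣ b 0 ∧ ¬ CentreIn b p q' then (b 0 : ℚ) / 2 - q' else 1 with hcq'
  have hcen_unit : ∀ (r : ℕ), ¬ CentreIn b p r →
      padicNorm p ((b 0 : ℚ) / 2 - r) = 1 := by
    intro r hr
    have e : ((b 0 : ℚ) / 2 - r) = (((b 0 - 2 * r : ℤ)) : ℚ) / 2 := by push_cast; ring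
    rw [e, padicNorm.div, htwo, div_one]
    refine (padicNorm.int_eq_one_iff _).2 fun hdvd => hr ?_
    unfold CentreIn
    have : (p : ℤ) ∣ -(b 0 - 2 * (r : ℤ)) := (dvd_neg).2 hdvd
    simpa [neg_sub, sub_eq_neg_add] using this
  have hcq1 : padicNorm p cq = 1 := by
    rw [hcq]; split_ifs with h
    · exact hcen_unit q h.2
    · simp
  have hcq'1 : padicNorm p cq' = 1 := by
    rw [hcq']; split_ifs with h
    · exact hcen_unit q' h.2
    · simp
  have hcdiff : padicNorm p (cq - cq') ≤ (p : ℚ) ^ (-(1 : ℤ)) := by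
    rw [hcq, hcq']
    by_cases h : ¬ (2 : ℤ) ∣ b 0 ∧ ¬ CentreIn b p q
    · have h' : ¬ (2 : ℤ) ∣ b 0 ∧ ¬ CentreIn b p q' := ⟨h.1, fun hc => h.2 (hcenq.2 (hcenq'.1 hc))⟩
      rw [if_pos h, if_pos h']
      have e : ((b 0 : ℚ) / 2 - q) - ((b 0 : ℚ) / 2 - q') = -((q : ℚ) - q') := by ring
      rw [e, padicNorm.neg]; exact hqq'
    · have h' : ¬ (¬ (2 : ℤ) ∣ b 0 ∧ ¬ CentreIn b p q') := fun hc => h ⟨hc.1, fun hcc => hc.2 (hcenq'.2 (hcenq.1 hcc))⟩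
      rw [if_neg h, if_neg h', sub_self, padicNorm.zero]; exact zpow_p_nonneg _
  -- assemble
  have hgq : gHat b p q = 2 * (∏ s ∈ S, ((s : ℚ) - q) ^ netExp b s) * cq := rfl
  have hgq' : gHat b p q' = 2 * (∏ s ∈ S, ((s : ℚ) - q') ^ netExp b s) * cq' := by
    rw [gHat, hS']
  have hnorm : padicNorm p (gHat b p q) = 1 := by
    rw [hgq, padicNorm.mul, padicNorm.mul, htwo, hprodq, hcq1]; norm_num
  refine ⟨?_, fun hne => ?_⟩
  · by_cases h0 : gHat b p q = 0
    · rw [h0, padicNorm.zero] at hnorm; exact absurd hnorm zero_ne_one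
    · exact padicValRat_eq_zero_of_norm_one h0 hnorm
  · have hdiff : padicNorm p (gHat b p q - gHat b p q') ≤ (p : ℚ) ^ (-(1 : ℤ)) := by
      rw [hgq, hgq', mul_assoc, mul_assoc, ← mul_sub, padicNorm.mul, htwo, one_mul]
      exact padicNorm_mul_sub_mul_le hprodq.le hcq'1.le hproddiff hcdiff
    exact val_ge_of_padicNorm_le (sub_ne_zero.2 hne) hdiff

end Summit.KontsevichZagierPeriods.Zeta5Search.CellA

end
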